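import Summits.Schanuel.Schanuel.Theorems.RootDecomp1BDefectFloorCellsPi
import Summits.Schanuel.Schanuel.Theorems.RootDecomp1BDefectFloorCore
import Literature.NumberTheory.Transcendental.LindemannWeierstrassProofs

/-!
# RootDecomp1BDefectFloorChannels — part 1 of 3 (lens-4 g10 NODE «Channels» = ROUND 10 of route-Schanuel-RootDecomp1B, a THEOREM ROUND;
# § Gen 10 of HOME/decomp-schanuel-lens-4/g10/Channels.lean (c3aeda0d…), `--supports stmt-Schanuel-32406`)

The floor SRL(r′ ∣ u) is a THREE-CHANNEL statement: ONE of the coordinate u / modulus e^u / phase e^{iu} of the last coordinate is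
transcendental over the polar field F(r′) (`sharpRelativeLindemannAt_of_coordinate` / `_modulus` / `_phase_channel`). New decided cells with a
DARK coordinate channel: the LW phase family (β ∣ γ + qπ) ∀ m and modulus family (β ∣ γ + log α) ∀ m (`algebraicIndependent_exp_holds`), the
Nesterenko cells (π ∣ log Γ(1/4)) and (π ∣ arctan Γ(1/4)) (mod `nesterenko`); channel certificates; the census theorem «rounds ≤ 9 were
coordinate-only». Extracted mechanically (dependency closure over the landed DefectFloor files: 64 § Gen 10 declarations + 11 earlier ones never
landed — `relDeg`, `polarDeg_eq_init_add_relDeg`, `sharpRelativeLindemannAt_iff_relDeg`, `one_le_relDeg_of_transcendental`, `init_piGamma`, …);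
all parts share the namespace `Summit.Schanuel.Schanuel.Theorems.RootDecomp1BDefectFloorChannels`; twins of landed declarations are `open`ed
(FedFlagCore / TameFlagCore / DefectFloorDefs / Core / Cells) or private copies; sorry-free; standard axioms.
-/

open Complex IntermediateField
open Literature.NumberTheory.Transcendental (trdeg_adjoin_le_of_le isAlgebraic_adjoin_over_algebraAdjoin nesterenko algebraicIndependent_exp_holds transcendental_pi_holds)

namespace Summit.Schanuel.Schanuel.Theorems.RootDecomp1BDefectFloorChannels

set_option linter.dupNamespace false

open Summit.Schanuel.Schanuel.Theorems.RootDecomp1BFedFlagCore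
open Summit.Schanuel.Schanuel.Theorems.RootDecomp1BTameFlagCore
open Summit.Schanuel.Schanuel.Theorems.RootDecomp1BDefectFloorDefs
open Summit.Schanuel.Schanuel.Theorems.RootDecomp1BDefectFloorCore
open Summit.Schanuel.Schanuel.Theorems.RootDecomp1BDefectFloorCells

section

variable {m : ℕ}

/-- RELATIVE DEGREE of the last coordinate over the polar field of the initial hyperplane `r' = Fin.init r`:
`relDeg r = trdeg_{F(r')} F(r')(u, u i, e^u, e^{u i})`. -/
noncomputable def relDeg {m : ℕ} (r : Fin (m + 1) → ℝ) : Cardinal :=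
  Algebra.trdeg ↥(polarField (Fin.init r)) ↥(IntermediateField.adjoin ↥(polarField (Fin.init r)) (lastGens r))

/-- Monotonicity of transcendence degree under inclusion of generators. [folklore] -/
private theorem trdeg_adjoin_mono {S T : Set ℂ} (h : S ⊆ T) :
    Algebra.trdeg ℚ ↥(IntermediateField.adjoin ℚ S) ≤ Algebra.trdeg ℚ ↥(IntermediateField.adjoin ℚ T) :=
  trdeg_le_of_injective (IntermediateField.inclusion (IntermediateField.adjoin.mono ℚ S T h))
    (IntermediateField.inclusion_injective _)

set_option synthInstance.maxHeartbeats 200000 in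
/-- Tower law for generated fields: `trdeg K(S ∪ T) = trdeg K(S) + trdeg_{K(S)} K(S)(T)`
(`trdeg_add_eq`, `adjoin_adjoin_left`). [folklore; lens-2 `DefectLattice.trdeg_adjoin_union_eq`] -/
private theorem trdeg_adjoin_union_eq {K E : Type*} [Field K] [Field E] [Algebra K E] (S T : Set E) :
    Algebra.trdeg K (adjoin K (S ∪ T)) =
      Algebra.trdeg K (adjoin K S) + Algebra.trdeg (adjoin K S) (adjoin (adjoin K S) T) := by
  have htower := trdeg_add_eq K (adjoin K S) (A := adjoin (adjoin K S) T)
  have heq : Algebra.trdeg K (adjoin (adjoin K S) T) = Algebra.trdeg K (adjoin K (S ∪ T)) := by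
    rw [← (equivOfEq (adjoin_adjoin_left K S T)).trdeg_eq]
    rfl
  rw [← heq, htower]

set_option synthInstance.maxHeartbeats 200000 in
/-- `T` algebraic over `K` ⟹ `trdeg_ℚ ℚ(T) ≤ trdeg_ℚ K`. [folklore; lens-2 `DefectLattice.trdeg_adjoin_le_of_isAlgebraic`] -/
private theorem trdeg_adjoin_le_of_isAlgebraic (K : IntermediateField ℚ ℂ) {T : Set ℂ}
    (hT : ∀ x ∈ T, IsAlgebraic K x) :
    Algebra.trdeg ℚ ↥(adjoin ℚ T) ≤ Algebra.trdeg ℚ ↥K := by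
  have hmono : Algebra.trdeg ℚ ↥(adjoin ℚ T) ≤ Algebra.trdeg ℚ ↥(adjoin ℚ ((K : Set ℂ) ∪ T)) :=
    trdeg_adjoin_mono Set.subset_union_right
  refine hmono.trans (le_of_eq ?_)
  haveI : Algebra.IsAlgebraic K (adjoin K T) :=
    isAlgebraic_adjoin fun x hx => (hT x hx).isIntegral
  have h := trdeg_add_eq ℚ K (A := adjoin K T)
  rw [trdeg_eq_zero (R := K) (A := adjoin K T), add_zero] at h
  have e := (equivOfEq (restrictScalars_adjoin ℚ K T)).symm.trdeg_eq
  calc Algebra.trdeg ℚ ↥(adjoin ℚ ((K : Set ℂ) ∪ T))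
      = Algebra.trdeg ℚ ↥((adjoin K T).restrictScalars ℚ) := e
    _ = Algebra.trdeg ℚ ↥(adjoin K T) := rfl
    _ = Algebra.trdeg ℚ ↥K := h.symm

/-- `i` is algebraic over `ℚ` … -/
private theorem isAlgebraic_I_rat : IsAlgebraic ℚ Complex.I :=
  IsAlgebraic.of_pow two_pos (by rw [Complex.I_sq]; exact isAlgebraic_one.neg)

set_option synthInstance.maxHeartbeats 200000 in
/-- TOWER LAW OF THE FLAG: `t(r) = t(r') + relDeg r`. -/
theorem polarDeg_eq_init_add_relDeg (r : Fin (m + 1) → ℝ) :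
    polarDeg r = polarDeg (Fin.init r) + relDeg r :=
  calc polarDeg r
      = Algebra.trdeg ℚ ↥(IntermediateField.adjoin ℚ (polarGens (Fin.init r) ∪ lastGens r)) :=
        (equivOfEq (polarField_succ r)).trdeg_eq
    _ = Algebra.trdeg ℚ ↥(IntermediateField.adjoin ℚ (polarGens (Fin.init r))) +
          Algebra.trdeg ↥(IntermediateField.adjoin ℚ (polarGens (Fin.init r)))
            ↥(IntermediateField.adjoin ↥(IntermediateField.adjoin ℚ (polarGens (Fin.init r))) (lastGens r)) :=
        trdeg_adjoin_union_eq (K := ℚ) _ _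
    _ = polarDeg (Fin.init r) + relDeg r := rfl

/-- `(lastGens r).Finite`. -/
theorem lastGens_finite (r : Fin (m + 1) → ℝ) : (lastGens r).Finite := by
  unfold lastGens
  exact (((Set.finite_singleton _).insert _).insert _).insert _

/-- `relDeg r < Cardinal.aleph0`. -/
theorem relDeg_lt_aleph0 (r : Fin (m + 1) → ℝ) : relDeg r < Cardinal.aleph0 :=
  (trdeg_adjoin_le_cardinalMk (F := ↥(polarField (Fin.init r))) (lastGens r)).trans_lt (lastGens_finite r).lt_aleph0

set_option synthInstance.maxHeartbeats 200000 in
/-- One generator transcendental over `F(r')` gives `relDeg ≥ 1`. -/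
theorem one_le_relDeg_of_transcendental {r : Fin (m + 1) → ℝ} {x : ℂ} (hx : x ∈ lastGens r)
    (hT : Transcendental ↥(polarField (Fin.init r)) x) : 1 ≤ relDeg r := by
  have h1 : AlgebraicIndependent ↥(polarField (Fin.init r)) ![x] := algebraicIndependent_iff_transcendental.mpr hT
  let z' : Fin 1 → ↥(adjoin (↥(polarField (Fin.init r))) (lastGens r)) := fun _ => ⟨x, subset_adjoin _ _ hx⟩
  have hz' : AlgebraicIndependent ↥(polarField (Fin.init r)) z' := by
    refine AlgebraicIndependent.of_comp (adjoin (↥(polarField (Fin.init r))) (lastGens r)).val ?_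
    convert h1 using 1
    funext i
    fin_cases i
    rfl
  have h2 := hz'.cardinalMk_le_trdeg
  rwa [Cardinal.mk_fintype, Fintype.card_fin, Nat.cast_one] at h2

/-- The floor in RELATIVE-DEGREE form: «relDeg ≥ 1 over a sharp hyperplane» … -/
theorem sharpRelativeLindemannAt_iff_relDeg (r : Fin (m + 1) → ℝ) :
    SharpRelativeLindemannAt m r ↔ (LinearIndependent ℚ r → KleinIH (m + 1) →
      polarDeg (Fin.init r) ≤ ((m + m : ℕ) : Cardinal) → 1 ≤ relDeg r) := by
  unfold SharpRelativeLindemannAt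
  have htower := polarDeg_eq_init_add_relDeg r
  obtain ⟨n', hn'⟩ := Cardinal.lt_aleph0.mp (polarDeg_lt_aleph0 (Fin.init r))
  obtain ⟨d, hd⟩ := Cardinal.lt_aleph0.mp (relDeg_lt_aleph0 r)
  obtain ⟨n, hn⟩ := Cardinal.lt_aleph0.mp (polarDeg_lt_aleph0 r)
  rw [hn', hd, hn] at htower
  rw [hn', hd, hn]
  constructor
  · intro h hr hIH hle
    have hIH' := two_mul_le_polarDeg_init hr hIH
    rw [hn'] at hIH'
    have h' := h hr hIH hle
    norm_cast at htower hIH' h' hle ⊢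
    omega
  · intro h hr hIH hle
    have hIH' := two_mul_le_polarDeg_init hr hIH
    rw [hn'] at hIH'
    have h' := h hr hIH hle
    norm_cast at htower hIH' h' hle ⊢
    omega

/-- `Fin.init piGamma = ![Real.pi]`. -/
theorem init_piGamma : Fin.init piGamma = ![Real.pi] := by
  funext j
  fin_cases j
  rfl

/-- CHANNEL LEMMA: the floor holds at `r` as soon as ONE of the last generators `u, ui, e^u, e^{iu}` is transcendental over
the polar field of the hyperplane `F(r')` (then `relDeg r ≥ 1`; with KleinIH `t(r') ≥ 2m`). -/
theorem sharpRelativeLindemannAt_of_transcendental_lastGen {r : Fin (m + 1) → ℝ} {x : ℂ} (hx : x ∈ lastGens r)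
    (hT : Transcendental ↥(polarField (Fin.init r)) x) : SharpRelativeLindemannAt m r :=
  (sharpRelativeLindemannAt_iff_relDeg r).mpr fun _ _ _ => one_le_relDeg_of_transcendental hx hT

/-- COORDINATE channel: `u ∉ acl F(r')` decides the cell. -/
theorem sharpRelativeLindemannAt_of_coordinate_channel {r : Fin (m + 1) → ℝ}
    (hT : Transcendental ↥(polarField (Fin.init r)) ((r (Fin.last m) : ℝ) : ℂ)) : SharpRelativeLindemannAt m r :=
  sharpRelativeLindemannAt_of_transcendental_lastGen (by simp [lastGens]) hT

/-- MODULUS channel: `e^u ∉ acl F(r')` decides the cell. -/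
theorem sharpRelativeLindemannAt_of_modulus_channel {r : Fin (m + 1) → ℝ}
    (hT : Transcendental ↥(polarField (Fin.init r)) (Complex.exp ((r (Fin.last m) : ℝ) : ℂ))) :
    SharpRelativeLindemannAt m r :=
  sharpRelativeLindemannAt_of_transcendental_lastGen (by simp [lastGens]) hT

/-- PHASE channel: `e^{iu} ∉ acl F(r')` decides the cell. -/
theorem sharpRelativeLindemannAt_of_phase_channel {r : Fin (m + 1) → ℝ}
    (hT : Transcendental ↥(polarField (Fin.init r)) (Complex.exp (((r (Fin.last m) : ℝ) : ℂ) * Complex.I))) :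
    SharpRelativeLindemannAt m r :=
  sharpRelativeLindemannAt_of_transcendental_lastGen (by simp [lastGens]) hT

/-- a member of `K` is algebraic over `K`. -/
theorem isAlgebraic_of_mem_subfield {F : Type*} [Field F] [Algebra F ℂ] (K : IntermediateField F ℂ) {x : ℂ} (hx : x ∈ K) :
    IsAlgebraic (↥K) x :=
  isAlgebraic_algebraMap (⟨x, hx⟩ : ↥K)

/-- `x ^ n ∈ K` for some `n > 0` makes `x` algebraic over `K`. -/
theorem isAlgebraic_of_pow_mem_subfield {F : Type*} [Field F] [Algebra F ℂ] (K : IntermediateField F ℂ) {x : ℂ} {n : ℕ}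
    (hn : 0 < n) (hx : x ^ n ∈ K) : IsAlgebraic (↥K) x :=
  IsAlgebraic.of_pow hn (isAlgebraic_of_mem_subfield K hx)

/-- TRANSPORT: `k` algebraically independent complex numbers, each ALGEBRAIC OVER `K`, give `k ≤ trdeg_ℚ K`. -/
theorem natCast_le_trdeg_of_isAlgebraic {k : ℕ} (K : IntermediateField ℚ ℂ) {z : Fin k → ℂ}
    (hz : AlgebraicIndependent ℚ z) (halg : ∀ i, IsAlgebraic (↥K) (z i)) :
    (k : Cardinal) ≤ Algebra.trdeg ℚ ↥K :=
  (natCast_le_trdeg_of_algebraicIndependent (L := IntermediateField.adjoin ℚ (Set.range z)) hz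
      fun i => subset_adjoin ℚ _ ⟨i, rfl⟩).trans
    (trdeg_adjoin_le_of_isAlgebraic K (by
      rintro x ⟨i, rfl⟩
      exact halg i))

/-- `e^{r_j} ∈ polarGens r` … -/
theorem exp_coe_mem_polarGens {k : ℕ} (r : Fin k → ℝ) (j : Fin k) : Complex.exp ((r j : ℝ) : ℂ) ∈ polarGens r :=
  Or.inr ⟨Fin.castAdd k j, by simp only [Function.comp_apply, Fin.append_left]⟩

/-- … and `e^{i r_j} ∈ polarGens r`. -/
theorem exp_coe_mul_I_mem_polarGens {k : ℕ} (r : Fin k → ℝ) (j : Fin k) :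
    Complex.exp (((r j : ℝ) : ℂ) * Complex.I) ∈ polarGens r :=
  Or.inr ⟨Fin.natAdd k j, by simp only [Function.comp_apply, Fin.append_right]⟩

/-- `(2 : ℂ) ∈ K`. -/
theorem two_mem {F : Type*} [Field F] [Algebra F ℂ] (K : IntermediateField F ℂ) : (2 : ℂ) ∈ K := by
  rw [show (2 : ℂ) = 1 + 1 by norm_num]
  exact add_mem (one_mem K) (one_mem K)

/-- if `e^{iz}` and `e^{-iz}`… : `cos z` lies in any subfield containing `e^{iz}` (and its inverse). -/
theorem cos_mem_of_exp_mul_I_mem {F : Type*} [Field F] [Algebra F ℂ] (K : IntermediateField F ℂ) {z : ℂ}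
    (hE : Complex.exp (z * Complex.I) ∈ K) : Complex.cos z ∈ K := by
  have hE' : Complex.exp (-z * Complex.I) ∈ K := by
    rw [neg_mul, Complex.exp_neg]
    exact inv_mem hE
  have hc : Complex.cos z = (Complex.exp (z * Complex.I) + Complex.exp (-z * Complex.I)) / 2 := by
    rw [← Complex.two_cos, mul_div_cancel_left₀ _ (two_ne_zero)]
  rw [hc]
  exact div_mem (add_mem hE hE') (two_mem K)

/-- `sin z` lies in any subfield containing `e^{iz}` and `i`. -/
theorem sin_mem_of_exp_mul_I_mem {F : Type*} [Field F] [Algebra F ℂ] (K : IntermediateField F ℂ) {z : ℂ}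
    (hE : Complex.exp (z * Complex.I) ∈ K) (hI : Complex.I ∈ K) : Complex.sin z ∈ K := by
  have hs : Complex.sin z = (Complex.exp (z * Complex.I) - Complex.cos z) / Complex.I := by
    rw [eq_div_iff Complex.I_ne_zero, ← Complex.cos_add_sin_I]
    ring
  rw [hs]
  exact div_mem (sub_mem hE (cos_mem_of_exp_mul_I_mem K hE)) hI

/-- PHASE ALGEBRA: `tan u ∈ K` as soon as `e^{iu} ∈ K` and `i ∈ K`. -/
theorem tan_mem_of_exp_mul_I_mem {F : Type*} [Field F] [Algebra F ℂ] (K : IntermediateField F ℂ) {z : ℂ}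
    (hE : Complex.exp (z * Complex.I) ∈ K) (hI : Complex.I ∈ K) : Complex.tan z ∈ K := by
  rw [Complex.tan_eq_sin_div_cos]
  exact div_mem (sin_mem_of_exp_mul_I_mem K hE hI) (cos_mem_of_exp_mul_I_mem K hE)

/-- `q · den q = num q` read in `ℂ`. -/
theorem rat_mul_den_complex (q : ℚ) : (q : ℂ) * (q.den : ℂ) = (q.num : ℂ) := by
  have h : ((q * q.den : ℚ) : ℂ) = ((q.num : ℚ) : ℂ) := by rw [Rat.mul_den_eq_num]
  push_cast at h
  exact h

/-- `e^{iqπ}` is a root of unity: `(e^{iqπ})^{2 den q} = 1`. -/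
theorem exp_rat_mul_pi_mul_I_pow (q : ℚ) :
    Complex.exp ((((q : ℝ) * Real.pi : ℝ) : ℂ) * Complex.I) ^ (2 * q.den) = 1 := by
  rw [← Complex.exp_nat_mul]
  have e : ((2 * q.den : ℕ) : ℂ) * (((((q : ℝ) * Real.pi : ℝ) : ℂ)) * Complex.I) =
      (q.num : ℂ) * (2 * Real.pi * Complex.I) := by
    rw [← rat_mul_den_complex q]
    push_cast
    ring
  rw [e, Complex.exp_int_mul_two_pi_mul_I]

/-- … hence algebraic over `ℚ`. -/
theorem isAlgebraic_exp_rat_mul_pi_mul_I (q : ℚ) :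
    IsAlgebraic ℚ (Complex.exp ((((q : ℝ) * Real.pi : ℝ) : ℂ) * Complex.I)) :=
  IsAlgebraic.of_pow (Nat.mul_pos two_pos q.den_pos) (by
    rw [exp_rat_mul_pi_mul_I_pow]
    exact isAlgebraic_one)

/-- `(e^{qπi})⁻¹` is algebraic for rational `q`. -/
theorem isAlgebraic_inv_exp_rat_mul_pi_mul_I (q : ℚ) :
    IsAlgebraic ℚ (Complex.exp ((((q : ℝ) * Real.pi : ℝ) : ℂ) * Complex.I))⁻¹ :=
  mem_algebraicClosure_iff.mp (inv_mem (mem_algebraicClosure_iff.mpr (isAlgebraic_exp_rat_mul_pi_mul_I q)))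

/-- `tan(qπ)` is algebraic for rational `q` (it lies in `ℚ(i, e^{iqπ})`). -/
theorem isAlgebraic_tan_rat_mul_pi (q : ℚ) :
    IsAlgebraic ℚ (Complex.tan ((((q : ℝ) * Real.pi : ℝ) : ℂ))) :=
  mem_algebraicClosure_iff.mp (tan_mem_of_exp_mul_I_mem (algebraicClosure ℚ ℂ)
    (mem_algebraicClosure_iff.mpr (isAlgebraic_exp_rat_mul_pi_mul_I q)) (mem_algebraicClosure_iff.mpr isAlgebraic_I_rat))

/-- π is transcendental — in `ℂ` (the tree's `transcendental_pi_holds`, Lindemann 1882, proved from Lindemann–Weierstrass). -/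
theorem transcendental_coe_pi : Transcendental ℚ ((Real.pi : ℝ) : ℂ) := fun hπ =>
  Literature.NumberTheory.Transcendental.transcendental_pi_holds
    ((isAlgebraic_algebraMap_iff (algebraMap ℝ ℂ).injective).mp hπ)

/-- `(x | i y)` is `ℚ`-free in `ℂ` for `ℚ`-free real tuples `x`, `y` (real and imaginary parts separate). -/
theorem linearIndependent_append_mul_I {a b : ℕ} {x : Fin a → ℝ} {y : Fin b → ℝ}
    (hx : LinearIndependent ℚ x) (hy : LinearIndependent ℚ y) :
    LinearIndependent ℚ (Fin.append (fun j => ((x j : ℝ) : ℂ)) (fun j => ((y j : ℝ) : ℂ) * Complex.I)) := by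
  rw [Fintype.linearIndependent_iff] at hx hy ⊢
  intro c hc
  rw [Fin.sum_univ_add] at hc
  simp only [Fin.append_left, Fin.append_right] at hc
  have hre : ((∑ i : Fin a, c (Fin.castAdd b i) • x i : ℝ) : ℂ) =
      ∑ i : Fin a, c (Fin.castAdd b i) • ((x i : ℝ) : ℂ) := by
    rw [Complex.ofReal_sum]
    refine Finset.sum_congr rfl fun j _ => ?_
    rw [Rat.smul_def, Rat.smul_def, Complex.ofReal_mul, Complex.ofReal_ratCast]
  have him : ((∑ i : Fin b, c (Fin.natAdd a i) • y i : ℝ) : ℂ) * Complex.I =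
      ∑ i : Fin b, c (Fin.natAdd a i) • (((y i : ℝ) : ℂ) * Complex.I) := by
    rw [Complex.ofReal_sum, Finset.sum_mul]
    refine Finset.sum_congr rfl fun j _ => ?_
    rw [Rat.smul_def, Rat.smul_def, Complex.ofReal_mul, Complex.ofReal_ratCast, mul_assoc]
  rw [← hre, ← him] at hc
  have h0 := congrArg Complex.re hc
  have h1 := congrArg Complex.im hc
  simp only [Complex.add_re, Complex.ofReal_re, Complex.mul_re, Complex.I_re, Complex.I_im,
    Complex.ofReal_im, Complex.add_im, Complex.mul_im, Complex.zero_re, Complex.zero_im,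
    mul_zero, mul_one, sub_zero, zero_add, add_zero] at h0 h1
  have hc1 : ∀ i : Fin a, c (Fin.castAdd b i) = 0 :=
    hx (fun i => c (Fin.castAdd b i)) (by simpa using h0)
  have hc2 : ∀ i : Fin b, c (Fin.natAdd a i) = 0 :=
    hy (fun i => c (Fin.natAdd a i)) (by simpa using h1)
  intro k
  refine Fin.addCases (fun i => ?_) (fun i => ?_) k
  · exact hc1 i
  · exact hc2 i

/-- the coordinates of `(β | γ)` are algebraic. -/
theorem isAlgebraic_snoc (β : Fin m → ℝ) (γ : ℝ) (hβ : ∀ j, IsAlgebraic ℚ ((β j : ℝ) : ℂ))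
    (hγ : IsAlgebraic ℚ ((γ : ℝ) : ℂ)) (j : Fin (m + 1)) :
    IsAlgebraic ℚ ((((Fin.snoc β γ : Fin (m + 1) → ℝ) j : ℝ)) : ℂ) := by
  rcases Fin.eq_castSucc_or_eq_last j with ⟨j, rfl⟩ | rfl
  · simp only [Fin.snoc_castSucc]; exact hβ j
  · simp only [Fin.snoc_last]; exact hγ

/-- the PHASE family: the 2m + 1 exponentials of `β_j, iβ_j, iγ` are algebraic over any field containing `e^{β_j}`,
`e^{iβ_j}` over which `e^{iγ}` is algebraic. -/
theorem isAlgebraic_exp_phaseFamily (β : Fin m → ℝ) (γ : ℝ) (L : IntermediateField ℚ ℂ)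
    (h1 : ∀ j, Complex.exp ((β j : ℝ) : ℂ) ∈ L) (h2 : ∀ j, Complex.exp (((β j : ℝ) : ℂ) * Complex.I) ∈ L)
    (hu : IsAlgebraic ↥L (Complex.exp (((γ : ℝ) : ℂ) * Complex.I))) (k : Fin (m + (m + 1))) :
    IsAlgebraic ↥L (Complex.exp (Fin.append (fun j => ((β j : ℝ) : ℂ))
        (fun j => (((Fin.snoc β γ : Fin (m + 1) → ℝ) j : ℝ) : ℂ) * Complex.I) k)) := by
  induction k using Fin.addCases with
  | left j => simpa only [Fin.append_left] using isAlgebraic_of_mem_subfield L (h1 j)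
  | right j =>
    rcases Fin.eq_castSucc_or_eq_last j with ⟨j, rfl⟩ | rfl
    · simpa only [Fin.append_right, Fin.snoc_castSucc] using isAlgebraic_of_mem_subfield L (h2 j)
    · simpa only [Fin.append_right, Fin.snoc_last] using hu

/-- PHASE TRANSPORT: for β_j, γ real algebraic with (β, γ) `ℚ`-free, every field `L` containing `e^{β_j}, e^{iβ_j}` over
which `e^{iγ}` is ALGEBRAIC has `trdeg_ℚ L ≥ 2m + 1` [Lindemann–Weierstrass `algebraicIndependent_exp_holds` + transport]. -/
theorem floor_of_phase_algebraic (β : Fin m → ℝ) (γ : ℝ) (hβ : ∀ j, IsAlgebraic ℚ ((β j : ℝ) : ℂ))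
    (hγ : IsAlgebraic ℚ ((γ : ℝ) : ℂ)) (hli : LinearIndependent ℚ (Fin.snoc β γ : Fin (m + 1) → ℝ))
    (L : IntermediateField ℚ ℂ) (h1 : ∀ j, Complex.exp ((β j : ℝ) : ℂ) ∈ L)
    (h2 : ∀ j, Complex.exp (((β j : ℝ) : ℂ) * Complex.I) ∈ L)
    (hu : IsAlgebraic ↥L (Complex.exp (((γ : ℝ) : ℂ) * Complex.I))) :
    ((m + m + 1 : ℕ) : Cardinal) ≤ Algebra.trdeg ℚ ↥L := by
  have hβli : LinearIndependent ℚ β := (linearIndependent_finSnoc.mp hli).1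
  have hz := linearIndependent_append_mul_I hβli hli
  have halg : ∀ k, IsAlgebraic ℚ (Fin.append (fun j => ((β j : ℝ) : ℂ))
      (fun j => (((Fin.snoc β γ : Fin (m + 1) → ℝ) j : ℝ) : ℂ) * Complex.I) k) := by
    intro k
    induction k using Fin.addCases with
    | left j => simpa only [Fin.append_left] using hβ j
    | right j => simpa only [Fin.append_right] using (isAlgebraic_snoc β γ hβ hγ j).mul isAlgebraic_I_rat
  have hLW := Literature.NumberTheory.Transcendental.algebraicIndependent_exp_holds _ halg hz
  have h := natCast_le_trdeg_of_isAlgebraic L hLW fun k => isAlgebraic_exp_phaseFamily β γ L h1 h2 hu k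
  have e : m + (m + 1) = m + m + 1 := by omega
  rw [e] at h
  exact h

/-- in F(β | γ + qπ) the phase `e^{iγ} = e^{iu} · (e^{iqπ})⁻¹` is ALGEBRAIC (a root of unity away from a generator). -/
theorem isAlgebraic_exp_gamma_mul_I_phaseShift (β : Fin m → ℝ) (γ : ℝ) (q : ℚ) :
    IsAlgebraic ↥(polarField (Fin.snoc β (γ + q * Real.pi) : Fin (m + 1) → ℝ))
      (Complex.exp (((γ : ℝ) : ℂ) * Complex.I)) := by
  have hu := exp_coe_mul_I_mem_polarField (Fin.snoc β (γ + q * Real.pi) : Fin (m + 1) → ℝ) (Fin.last m)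
  simp only [Fin.snoc_last] at hu
  have e : Complex.exp (((γ : ℝ) : ℂ) * Complex.I) =
      Complex.exp ((((γ + q * Real.pi : ℝ)) : ℂ) * Complex.I) *
        (Complex.exp ((((q : ℝ) * Real.pi : ℝ) : ℂ) * Complex.I))⁻¹ := by
    rw [← Complex.exp_neg, ← Complex.exp_add]
    congr 1
    push_cast
    ring
  rw [e]
  exact (isAlgebraic_of_mem_subfield _ hu).mul ((isAlgebraic_inv_exp_rat_mul_pi_mul_I q).tower_top _)

end

end Summit.Schanuel.Schanuel.Theorems.RootDecomp1BDefectFloorChannels
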